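import Summits.AnomalousDissipation.AnomalousDissipation.Theorems.BaireTransferRobustLoudUpgradeStubDriftWeakOfClassical
import Summits.AnomalousDissipation.AnomalousDissipation.Theorems.BaireTransferRobustLoudUpgradeStubDriftLimit
import Summits.AnomalousDissipation.AnomalousDissipation.Theorems.BaireTransferRobustLoudUpgradeStubDriftRegularity
import Summits.AnomalousDissipation.AnomalousDissipation.Theorems.BaireTransferRobustLoudUpgradeStubDriftClassicalOfWeak

/-!
# Stub `stub_driftStratumClosed` of the line `malkin-cone-group-orbits`
# (crux stmt-AnomalousDissipation-1144, category package of lead c15, wave 4):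
# each viscosity stratum of the ANY-MEAN steady-loud set is closed

For `0 < ν₁` the coefficient vectors `c ∈ P_S` carrying a classical steady state of `NS_ν(f_c)` of
ANY mean at some viscosity `ν ∈ [ν₁, ν₂]` with budgets `meanEnergy ≤ E`, `meanDissipation ≥ ε`
form a CLOSED subset of `P_S` (the any-mean analogue of `Category.stub_steadyStratumClosed` of
`…StubSteadyStratumClosed`, whose structure is copied).  Proof (compactness with VARYING viscosity
and VARYING drift, through the drifted steady weak dictionary of wave 3): along `c_n → c` the
classical witnesses `(ν_n, u_n, p_n)` are drifted steady weak solutions `W_n ∈ V` with drift the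
mean `m_n = ∫ u_n` (`stub_driftWeakOfClassical`), `meanEnergy = ‖m_n‖² + ‖W_n‖² ≤ E` and
`meanDissipation = ν_n ‖∇W_n‖² = (W_n, f_{c_n})`; hence `‖m_n‖, ‖W_n‖ ≤ √E` and the uniform
enstrophy bound `‖∇W_n‖² ≤ √E · M / ν₁` (`M` a bound of `‖f_{c_n}‖₂`).  Rellich
(`isCompact_setOf_eGradNormSq_le`), the compact slab `[ν₁, ν₂]` and the compact ball of drifts in
`ℝ³` give a subsequence `W_n → W` in `H`, `ν_n → ν ∈ [ν₁, ν₂]`, `m_n → m`; the drifted weak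
formulation has closed graph (`stub_driftLimit`), the limit `W ∈ V` has a smooth representative
(`stub_driftRegularity`) and `m + W` is a classical steady state of `NS_ν(f_c)`
(`stub_driftClassicalOfWeak`) with the limiting budgets `‖m‖² + ‖W‖² ≤ E`, `(W, f_c) ≥ ε`.
-/

-- `Summit.<Summit>.<Problem>` is the tree's mandated summit-side namespace (CONVENTIONS §2); for this
-- single-conjunct summit the two coincide, so the duplicate is deliberate.
set_option linter.dupNamespace false

noncomputable section

open scoped BigOperators Topology InnerProductSpace RealInnerProductSpace ENNReal
open Filter Set Function TopologicalSpace MeasureTheory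

namespace Summit.AnomalousDissipation.AnomalousDissipation.Theorems.RobustLoudUpgrade.Category

open Literature.Analysis.FunctionSpaces Literature.Analysis.FunctionSpaces.Torus
open Literature.Analysis.FluidPDE Literature.Analysis.FluidPDE.Torus
open Summit.AnomalousDissipation.AnomalousDissipation.Theses.BaireTransfer
open Summit.AnomalousDissipation.AnomalousDissipation.Theorems.DenseLoudDesignerForces
open Summit.AnomalousDissipation.AnomalousDissipation.Theorems.RobustLoudUpgrade.CensusInterior

/-! ## The stub -/

/-- **stub_driftStratumClosed** (registered sub-goal of lead c15's category package, wave 4).  For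
`0 < ν₁` the coefficient vectors carrying a classical steady state of `NS_ν(f_c)` of ANY mean at some
viscosity `ν ∈ [ν₁, ν₂]` with budgets `meanEnergy ≤ E`, `meanDissipation ≥ ε` form a CLOSED subset of
`P_S`.  (Compactness: classical of mean `m` ⇒ drifted steady weak solution `W ∈ V` with drift `m`
and budgets `‖m‖² + ‖W‖²`, `ν‖∇W‖² = (W, f_c)`; uniform bounds `‖m‖ ≤ √E`, `‖∇W‖² ≤ √E‖f‖₂/ν₁`;
Rellich, the compact viscosity slab and the compact drift ball; the drifted weak formulation passes
to the limit; regularity and the drifted weak → classical dictionary give a classical steady state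
`m + v` of the limit force with the limiting budgets.) [folklore] -/
theorem stub_driftStratumClosed : ∀ (S : Finset (Fin 3 → ℤ)) (ν₁ ν₂ E ε : ℝ), 0 < ν₁ →
    IsClosed {c : Coeff S | ∃ ν : ℝ, ν₁ ≤ ν ∧ ν ≤ ν₂ ∧
      ∃ (u : UnitAddTorus (Fin 3) → EuclideanSpace ℝ (Fin 3)) (p : UnitAddTorus (Fin 3) → ℝ),
        Torus.IsSteadyNSState ν (force S c) u p ∧
          meanEnergy (fun _ : ℝ => u) ≤ E ∧ ε ≤ meanDissipation ν (fun _ : ℝ => u)} := by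
  intro S ν₁ ν₂ E ε hν₁
  refine isClosed_of_closure_subset fun c hc => ?_
  obtain ⟨x, hxl, hxc⟩ := mem_closure_iff_seq_limit.1 hc
  choose nu hnu1 hnu2 u p hst hE hD using hxl
  have hnu0 : ∀ n, 0 < nu n := fun n => hν₁.trans_le (hnu1 n)
  -- the given classical witnesses as DRIFTED steady weak solutions in `V` (drift = the mean
  -- `∫ u n`), with their budgets
  choose U hUV hUw hUE hUD hUD' using fun n =>
    stub_driftWeakOfClassical (nu n) (force S (x n)) (u n) (p n) (hnu0 n) (isSmooth_force (x n))
      (hst n)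
  -- the forces in `L²`, uniformly bounded along the sequence
  set F := fun c' : Coeff S => (memLp_force c').toLp (force S c')
  have hFx : Tendsto (fun n => F (x n)) atTop (𝓝 (F c)) :=
    ((continuous_toLp_force S).tendsto c).comp hxc
  obtain ⟨M, hM⟩ := ((continuous_norm.tendsto _).comp hFx).bddAbove_range
  have hM' : ∀ n, ‖F (x n)‖ ≤ M := fun n => hM ⟨n, rfl⟩
  -- the energy budget bounds the drifts and the `L²` norms by `√E`
  have hEU : ∀ n, ‖∫ y, u n y‖ ^ 2 + ‖U n‖ ^ 2 ≤ E := fun n => (hUE n).ge.trans (hE n)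
  have hmB : ∀ n, ‖∫ y, u n y‖ ≤ Real.sqrt E := fun n =>
    (le_abs_self _).trans (Real.abs_le_sqrt (by nlinarith [hEU n, sq_nonneg ‖U n‖]))
  have hUB : ∀ n, ‖U n‖ ≤ Real.sqrt E := fun n =>
    (le_abs_self _).trans (Real.abs_le_sqrt (by nlinarith [hEU n, sq_nonneg ‖∫ y, u n y‖]))
  -- a fixed compact enstrophy ball of `H` containing every `U n` (viscosities `≥ ν₁`):
  -- `ν₁ ‖∇U n‖² ≤ ν_n ‖∇U n‖² = (U n, f_{c_n}) ≤ ‖U n‖ ‖f_{c_n}‖₂ ≤ √E · M`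
  set K : Set (energySpace (Fin 3)) := {w | eGradNormSq
    (w.1 : UnitAddTorus (Fin 3) → EuclideanSpace ℝ (Fin 3)) ≤ ENNReal.ofReal (Real.sqrt E * M / ν₁)}
  have hKc : IsCompact K := isCompact_setOf_eGradNormSq_le ENNReal.ofReal_ne_top
  have hUK : ∀ n, U n ∈ K := fun n => by
    have hfin : eGradNormSq ((U n).1 : UnitAddTorus (Fin 3) → EuclideanSpace ℝ (Fin 3)) ≠ ⊤ :=
      (hUV n).2.eGradNormSq_lt_top.ne
    have hg0 : 0 ≤ (eGradNormSq
        ((U n).1 : UnitAddTorus (Fin 3) → EuclideanSpace ℝ (Fin 3))).toReal := ENNReal.toReal_nonneg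
    have h1 : nu n * (eGradNormSq
        ((U n).1 : UnitAddTorus (Fin 3) → EuclideanSpace ℝ (Fin 3))).toReal ≤ ‖U n‖ * ‖F (x n)‖ := by
      rw [← hUD n, hUD' n]
      exact (le_abs_self _).trans (abs_pairing_coe_le (memLp_force (x n)) (U n))
    have h2 : ν₁ * (eGradNormSq
        ((U n).1 : UnitAddTorus (Fin 3) → EuclideanSpace ℝ (Fin 3))).toReal ≤ Real.sqrt E * M :=
      (mul_le_mul_of_nonneg_right (hnu1 n) hg0).trans
        (h1.trans (mul_le_mul (hUB n) (hM' n) (norm_nonneg _) (Real.sqrt_nonneg _)))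
    show eGradNormSq ((U n).1 : UnitAddTorus (Fin 3) → EuclideanSpace ℝ (Fin 3)) ≤
      ENNReal.ofReal (Real.sqrt E * M / ν₁)
    rw [← ENNReal.ofReal_toReal hfin]
    refine ENNReal.ofReal_le_ofReal ?_
    rw [le_div_iff₀ hν₁, mul_comm]
    exact h2
  -- subsequence: `U (φ n) → W` in `H`, `nu (φ n) → ν ∈ [ν₁, ν₂]`, `∫ u (φ n) → m` in `ℝ³`
  obtain ⟨⟨W, ν, m⟩, ⟨hWK, hνI, -⟩, φ, hφ, hlim⟩ :=
    (hKc.prod ((isCompact_Icc : IsCompact (Icc ν₁ ν₂)).prod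
      (isCompact_closedBall (0 : EuclideanSpace ℝ (Fin 3)) (Real.sqrt E)))).tendsto_subseq
      (x := fun n => (U n, nu n, ∫ y, u n y))
      fun n => Set.mk_mem_prod (hUK n)
        (Set.mk_mem_prod ⟨hnu1 n, hnu2 n⟩ (mem_closedBall_zero_iff.2 (hmB n)))
  have hlimU : Tendsto (fun n => U (φ n)) atTop (𝓝 W) := (continuous_fst.tendsto _).comp hlim
  have hlimν : Tendsto (fun n => nu (φ n)) atTop (𝓝 ν) :=
    (continuous_snd.fst.tendsto _).comp hlim
  have hlimm : Tendsto (fun n => ∫ y, u (φ n) y) atTop (𝓝 m) :=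
    (continuous_snd.snd.tendsto _).comp hlim
  have hWV : W.1 ∈ energySpaceV (Fin 3) := ⟨W.2, memSobolev_one_complexify_of_eGradNormSq_ne_top
    (Lp.memLp _) (ne_top_of_le_ne_top ENNReal.ofReal_ne_top hWK)⟩
  -- the limit is a drifted steady weak solution of `NS_ν(f_c)` with drift `m` (closed graph)
  have hWw := stub_driftLimit S (fun n => x (φ n)) c (fun n => nu (φ n)) ν (fun n => ∫ y, u (φ n) y)
    m (fun n => U (φ n)) W (hxc.comp hφ.tendsto_atTop) hlimν hlimm hlimU fun n => hUw (φ n)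
  -- its smooth representative, and the classical steady state `m + v` with the limiting budgets
  have hν : 0 < ν := hν₁.trans_le hνI.1
  obtain ⟨v, hv, hae⟩ := stub_driftRegularity ν m (force S c) W hν (isSmooth_force c) hWV hWw
  obtain ⟨q, hvst, -, -, hvE, hvD⟩ := stub_driftClassicalOfWeak ν m (force S c) W v hν
    (isSmooth_force c) (hasZeroMean_force c) hWV hWw hv hae
  refine ⟨ν, hνI.1, hνI.2, fun y => m + v y, q, hvst, ?_, ?_⟩
  · rw [hvE]
    have h1 : Tendsto (fun n => ‖∫ y, u (φ n) y‖ ^ 2 + ‖U (φ n)‖ ^ 2) atTop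
        (𝓝 (‖m‖ ^ 2 + ‖W‖ ^ 2)) :=
      (((continuous_norm.tendsto m).comp hlimm).pow 2).add
        (((continuous_norm.tendsto W).comp hlimU).pow 2)
    exact le_of_tendsto' h1 fun n => hEU (φ n)
  · rw [hvD, pairing_eq_inner (memLp_force c)]
    have h2 : Tendsto (fun n => ⟪(U (φ n)).1, F (x (φ n))⟫_ℝ) atTop (𝓝 ⟪W.1, F c⟫_ℝ) :=
      ((continuous_subtype_val.tendsto W).comp hlimU).inner (hFx.comp hφ.tendsto_atTop)
    refine ge_of_tendsto' h2 fun n => ?_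
    have h := hD (φ n)
    rw [hUD' (φ n), pairing_eq_inner (memLp_force (x (φ n)))] at h
    exact h

end Summit.AnomalousDissipation.AnomalousDissipation.Theorems.RobustLoudUpgrade.Category

end
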